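import Literature.NumberTheory.EllipticCurves.KugaSatoFibrePowerMap
import Literature.NumberTheory.EllipticCurves.KugaSatoVarietyBaseChangeHom
import HarnessLib

/-!
# `Γ`-equivariance of the base-change morphism of fibre powers `G^m : E'^m → E^m`

Topic: `Literature/NumberTheory/EllipticCurves`. For a base change of elliptic curves
`G : E' → E` over `g : S' → S` (`EllCurveOver.IsBaseChangeVia`, Katz–Mazur (2.1)) the induced
morphism `G^m : E'^m → E^m` of `KugaSatoFibrePowerMap.lean` intertwines the generators of Scholl's
group `Γ` (Deninger–Scholl 5.3 (i)) acting on `E'^m` and on `E^m`: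

* `KugaSato.mapFibrePower_transl` — translations by sections `s'`, `s` with `s' ≫ G = g ≫ s`
  (in particular, for a base change of level structures, the translations by the `N`-torsion
  sections `φ'(a, b)` and `φ(a, b)`: `mapFibrePower_transl_section_`);
* `KugaSato.mapFibrePower_neg` — the inversions in the factors;
* (`KugaSato.mapFibrePower_perm`, the permutations, is in `KugaSatoFibrePowerMap.lean`).

This is what transports the `Γ`-action along `Y ↪ Y(N)_K` or along `slY γ : Y → Y` in any
assembly of a `KugaSatoVariety`. All proved; no named facts.

## References

* C. Deninger, A. J. Scholl, *The Beilinson conjectures* (1991), 5.3 (i). [DeningerScholl1991]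
* N. Katz, B. Mazur, *Arithmetic moduli of elliptic curves* (1985), (2.1). [KatzMazur1985]
-/

universe u

open CategoryTheory Limits AlgebraicGeometry MonoidalCategory CartesianMonoidalCategory
open scoped MonObj

noncomputable section

namespace Literature.NumberTheory.EllipticCurves

namespace EllCurveOver.IsBaseChangeVia

variable {S S' : Scheme.{u}} {C' : EllCurveOver S'} {C : EllCurveOver S} {g : S' ⟶ S}
  {G : C'.E.left ⟶ C.E.left} (h : C'.IsBaseChangeVia C g G)

include h

/-- The push-forward of the identity point of `E'(E')` is `G` itself (as an `S`-morphism).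
[folklore] -/
theorem push_id : h.push C'.E (𝟙 C'.E) = h.homOver := by
  rw [push, CategoryTheory.Functor.map_id, Category.id_comp]

-- `((Over.map g).obj E').left = E'.left` by unfolding.
set_option backward.isDefEq.respectTransparency false in
/-- The push-forward of a constant point `E' → S' → E'` given by a section `s'` compatible with a
section `s` of `E` (`s' ≫ G = g ≫ s`) is the constant point of `E` given by `s`. [folklore] -/
theorem push_toUnit_comp (s' : C'.Sections) (s : C.Sections) (hs : s'.left ≫ G = g ≫ s.left) :
    h.push C'.E (toUnit C'.E ≫ s') = toUnit _ ≫ s := by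
  ext
  rw [push_left, Over.comp_left, Over.comp_left, Over.toUnit_left, Over.toUnit_left,
    Over.map_obj_hom, Category.assoc, hs, Category.assoc]

-- as above.
set_option backward.isDefEq.respectTransparency false in
/-- **`G` intertwines the translations**: for sections `s'` of `E'` and `s` of `E` with
`s' ≫ G = g ≫ s`, the right translations `x ↦ x · s'` of `E'` and `x ↦ x · s` of `E` satisfy
`(𝟙 · s') ≫ G = G ≫ (𝟙 · s)` on underlying schemes. [folklore] -/
theorem transl_left_comp (s' : C'.Sections) (s : C.Sections) (hs : s'.left ≫ G = g ≫ s.left) :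
    (𝟙 C'.E * (toUnit C'.E ≫ s')).left ≫ G = G ≫ (𝟙 C.E * (toUnit C.E ≫ s)).left := by
  have key := congr_arg CommaMorphism.left (h.push_mul C'.E (𝟙 C'.E) (toUnit C'.E ≫ s'))
  simp only [push_left, h.push_id, h.push_toUnit_comp s' s hs] at key
  rw [key]
  change _ = (h.homOver ≫ (𝟙 C.E * (toUnit C.E ≫ s))).left
  rw [MonObj.comp_mul, Category.comp_id, comp_toUnit_assoc]

end EllCurveOver.IsBaseChangeVia

namespace KugaSato

variable {S S' : Scheme.{u}} {C' : EllCurveOver S'} {C : EllCurveOver S} {g : S' ⟶ S}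
  {G : C'.E.left ⟶ C.E.left} (h : C'.IsBaseChangeVia C g G)

include h

/-- **`G^m` intertwines the translations** by compatible sections on the `i`-th factors
(Deninger–Scholl 5.3 (i), `(ℤ/n)^{2k}`: translations by sections of finite order).
[cite: DeningerScholl1991, 5.3 (i)] -/
theorem mapFibrePower_transl (m : ℕ) (i : Fin m) (s' : C'.Sections) (s : C.Sections)
    (hs : s'.left ≫ G = g ≫ s.left) :
    mapFibrePower g G h.w m ≫ (transl C.E m i s).left =
      (transl C'.E m i s').left ≫ mapFibrePower g G h.w m :=
  mapFibrePower_onFactor g G h.w m i _ _ (h.transl_left_comp s' s hs)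

/-- **`G^m` intertwines the inversions** in the `i`-th factors (Deninger–Scholl 5.3 (i), `μ₂^k`).
[cite: DeningerScholl1991, 5.3 (i)] -/
theorem mapFibrePower_neg (m : ℕ) (i : Fin m) :
    mapFibrePower g G h.w m ≫ (neg C.E m i).left = (neg C'.E m i).left ≫ mapFibrePower g G h.w m :=
  mapFibrePower_onFactor g G h.w m i _ _ h.inv_left_comp

omit h in
/-- For a base change of level structures `(E', φ') → (E, φ)`, `G^m` intertwines the
translations by the `N`-torsion sections `φ'(a, b)` and `φ(a, b)` on the `i`-th factors — the
generators `(ℤ/N)^{2m}` of Scholl's group. [cite: DeningerScholl1991, 5.3 (i)] -/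
theorem mapFibrePower_transl_section_ {N : ℕ} {φ' : C'.LevelStructure N} {φ : C.LevelStructure N}
    (hφ : φ'.IsBaseChangeVia φ g G) (m : ℕ) (i : Fin m) (ab : ZMod N × ZMod N) :
    mapFibrePower g G hφ.curve.w m ≫ (transl C.E m i (φ.section_ ab)).left =
      (transl C'.E m i (φ'.section_ ab)).left ≫ mapFibrePower g G hφ.curve.w m :=
  mapFibrePower_transl hφ.curve m i _ _ (hφ.section_left_comp ab)

end KugaSato

end Literature.NumberTheory.EllipticCurves

end
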